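import Summits.QuantumFields.YangMills.Theorems.BackwardLiouvilleRigidityFlatRatioTerminationConeGeometry

/-!
# Oscillation along the boundary of a lattice cell and the discrete CONE EXTENSION into the unit sphere
# (toolkit for the stub `stub_innerWindowGaugeSmall` of `BackwardLiouvilleRigidity.FlatRatioTermination`, stmt-QuantumFields-22542)

Continues `…ConeGeometry`: (§1) a function on the boundary `∂B` of a cell with bond oscillation `≤ σ` oscillates by at most
`σ·‖p − p'‖₁` between two points of one face (`face_osc`) or of two adjacent faces (`two_face_osc`); (§2) normalisation
`v ↦ v/‖v‖` in a real inner product space and the chord lower bound `‖−(1−λ)q + λp‖ ≥ ρ/2` for unit `p, q` with `‖p − q‖ ≥ ρ`;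
(§3) the DISCRETE CONE EXTENSION `T x = normalize (−(1 − lam x)•q + lam x • t (proj x))` of unit boundary data `t` missing the
ball `B(q, ρ)`: `T = t` on `∂B`, `‖T‖ = 1` everywhere, and bond oscillation `≤ (16/m + 12|D|σ)/ρ` on the box — quantitative
`π_{k−1}(S³) = 0` for cells of dimension `k = |D|`, with no dependence on the cell size beyond `1/m`.

HONEST SCOPE.  Elementary, `--supports stmt-QuantumFields-22542`; nothing about gauge fields, the crux, rung R3 or any summit
statement; nothing here bears on the Yang–Mills mass gap.
-/

namespace Summit.QuantumFields.YangMills.Theorems.FlatRatioTermination.Cone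

open Finset

namespace Cell

variable {d : ℕ} (c : Cell d)

/-! ### Oscillation along the boundary -/

section Paths

variable {E : Type*} [NormedAddCommGroup E]

/-- Boundary bond oscillation at most `σ`. [folklore] -/
def BdrySteps (t : (Fin d → ℤ) → E) (σ : ℝ) : Prop :=
  ∀ (x : Fin d → ℤ) (ι : Fin d), x ∈ c.bdry → x + Pi.single ι 1 ∈ c.bdry → ‖t x - t (x + Pi.single ι 1)‖ ≤ σ

/-- `l1norm` splits off one coordinate. [folklore] -/
theorem l1norm_eq_add_erase (v : Fin d → ℤ) (ι : Fin d) :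
    l1norm v = (v ι).natAbs + ∑ κ ∈ Finset.univ.erase ι, (v κ).natAbs := by
  unfold l1norm
  rw [← Finset.add_sum_erase _ _ (Finset.mem_univ ι)]

/-- `l1norm v = 0` forces `v = 0`. [folklore] -/
theorem eq_zero_of_l1norm_eq_zero {v : Fin d → ℤ} (h : l1norm v = 0) : v = 0 := by
  funext κ
  have := (Finset.sum_eq_zero_iff.mp h) κ (Finset.mem_univ κ)
  simpa using this

/-- WITHIN ONE FACE the oscillation is at most `σ` times the `ℓ¹` distance (monotone lattice paths stay in the face). [folklore] -/
theorem face_osc {t : (Fin d → ℤ) → E} {σ : ℝ} (ht : c.BdrySteps t σ) {κ : Fin d} (hκ : κ ∈ c.D)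
    {v : ℤ} (hv : v = c.lo κ ∨ v = c.lo κ + 2 * c.m) :
    ∀ (n : ℕ) (x y : Fin d → ℤ), x ∈ c.box → y ∈ c.box → x κ = v → y κ = v → l1norm (x - y) = n →
      ‖t x - t y‖ ≤ σ * n := by
  intro n
  induction n with
  | zero =>
    intro x y _ _ _ _ h0
    have : x = y := sub_eq_zero.mp (eq_zero_of_l1norm_eq_zero h0)
    subst this; simp
  | succ n ih =>
    intro x y hx hy hxκ hyκ hn
    -- a coordinate where `x` and `y` differ
    have hne : ∃ ι, x ι ≠ y ι := by
      by_contra h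
      push Not at h
      have : x - y = 0 := by funext ι; simp [h ι]
      rw [this] at hn; simp [l1norm] at hn
    obtain ⟨ι, hι⟩ := hne
    have hικ : ι ≠ κ := by rintro rfl; exact hι (hxκ.trans hyκ.symm)
    have hxb : x ∈ c.bdry := ⟨hx, κ, hκ, by rw [hxκ]; exact hv⟩
    have hsplit := l1norm_eq_add_erase (x - y) ι
    rcases lt_or_gt_of_ne hι with hlt | hgt
    · -- step up in direction `ι`
      set x' := x + Pi.single ι 1 with hx'
      have hx'b : x' ∈ c.box := by
        intro μ
        by_cases hμ : μ = ι
        · subst hμ; have := hx μ; have := hy μ; simp [hx']; constructor <;> omega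
        · have := hx μ; simp [hx', hμ]; exact this
      have hx'κ : x' κ = v := by simp [hx', hικ.symm, hxκ]
      have hx'bd : x' ∈ c.bdry := ⟨hx'b, κ, hκ, by rw [hx'κ]; exact hv⟩
      have hstep : ‖t x - t x'‖ ≤ σ := ht x ι hxb hx'bd
      have hn' : l1norm (x' - y) = n := by
        have h1 := l1norm_eq_add_erase (x' - y) ι
        have h2 : ∑ μ ∈ Finset.univ.erase ι, ((x' - y) μ).natAbs = ∑ μ ∈ Finset.univ.erase ι, ((x - y) μ).natAbs := by
          refine Finset.sum_congr rfl fun μ hμ => ?_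
          have hμ' : μ ≠ ι := Finset.ne_of_mem_erase hμ
          simp [hx', hμ']
        have h3 : ((x' - y) ι).natAbs + 1 = ((x - y) ι).natAbs := by
          simp only [hx', Pi.sub_apply, Pi.add_apply, Pi.single_eq_same]; omega
        omega
      calc ‖t x - t y‖ ≤ ‖t x - t x'‖ + ‖t x' - t y‖ := norm_sub_le_norm_sub_add_norm_sub _ _ _
        _ ≤ σ + σ * n := add_le_add hstep (ih x' y hx'b hy hx'κ hyκ hn')
        _ = σ * (n + 1 : ℕ) := by push_cast; ring
    · -- step down in direction `ι`
      set x' := x + Pi.single ι (-1) with hx'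
      have hxx' : x' + Pi.single ι 1 = x := by
        rw [hx', add_assoc, ← Pi.single_add]; simp
      have hx'b : x' ∈ c.box := by
        intro μ
        by_cases hμ : μ = ι
        · subst hμ; have := hx μ; have := hy μ; simp [hx']; constructor <;> omega
        · have := hx μ; simp [hx', hμ]; exact this
      have hx'κ : x' κ = v := by simp [hx', hικ.symm, hxκ]
      have hx'bd : x' ∈ c.bdry := ⟨hx'b, κ, hκ, by rw [hx'κ]; exact hv⟩
      have hstep : ‖t x' - t x‖ ≤ σ := by
        have := ht x' ι hx'bd (by rw [hxx']; exact hxb)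
        rwa [hxx'] at this
      have hn' : l1norm (x' - y) = n := by
        have h1 := l1norm_eq_add_erase (x' - y) ι
        have h2 : ∑ μ ∈ Finset.univ.erase ι, ((x' - y) μ).natAbs = ∑ μ ∈ Finset.univ.erase ι, ((x - y) μ).natAbs := by
          refine Finset.sum_congr rfl fun μ hμ => ?_
          have hμ' : μ ≠ ι := Finset.ne_of_mem_erase hμ
          simp [hx', hμ']
        have h3 : ((x' - y) ι).natAbs + 1 = ((x - y) ι).natAbs := by
          simp only [hx', Pi.sub_apply, Pi.add_apply, Pi.single_eq_same]; omega
        omega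
      calc ‖t x - t y‖ ≤ ‖t x - t x'‖ + ‖t x' - t y‖ := norm_sub_le_norm_sub_add_norm_sub _ _ _
        _ ≤ σ + σ * n := add_le_add (by rw [norm_sub_rev]; exact hstep) (ih x' y hx'b hy hx'κ hyκ hn')
        _ = σ * (n + 1 : ℕ) := by push_cast; ring

/-- ACROSS TWO ADJACENT FACES the oscillation is still at most `σ·‖p − p'‖₁` (path through the common edge). [folklore] -/
theorem two_face_osc {t : (Fin d → ℤ) → E} {σ : ℝ} (ht : c.BdrySteps t σ) {κ₁ κ₂ : Fin d}
    (h₁ : κ₁ ∈ c.D) (h₂ : κ₂ ∈ c.D) (hne : κ₁ ≠ κ₂) {p p' : Fin d → ℤ} (hp : p ∈ c.box) (hp' : p' ∈ c.box)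
    (hp₁ : p κ₁ = c.lo κ₁ ∨ p κ₁ = c.lo κ₁ + 2 * c.m) (hp₂ : p' κ₂ = c.lo κ₂ ∨ p' κ₂ = c.lo κ₂ + 2 * c.m) :
    ‖t p - t p'‖ ≤ σ * l1norm (p - p') := by
  set q := Function.update p κ₂ (p' κ₂) with hq
  have hqb : q ∈ c.box := by
    intro μ
    by_cases hμ : μ = κ₂
    · subst hμ; simp [hq]; exact hp' μ
    · simp [hq, hμ]; exact hp μ
  have hq₁ : q κ₁ = p κ₁ := by simp [hq, hne]
  have hq₂ : q κ₂ = p' κ₂ := by simp [hq]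
  have e1 := c.face_osc ht h₁ (v := p κ₁) hp₁ _ p q hp hqb rfl hq₁ rfl
  have e2 := c.face_osc ht h₂ (v := p' κ₂) hp₂ _ q p' hqb hp' hq₂ rfl rfl
  have hsum : l1norm (p - q) + l1norm (q - p') = l1norm (p - p') := by
    rw [l1norm_eq_add_erase (p - q) κ₂, l1norm_eq_add_erase (q - p') κ₂, l1norm_eq_add_erase (p - p') κ₂]
    have ha : ((q - p') κ₂).natAbs = 0 := by simp [hq₂]
    have hb : ((p - q) κ₂).natAbs = ((p - p') κ₂).natAbs := by simp [hq₂]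
    have hc : ∑ μ ∈ Finset.univ.erase κ₂, ((p - q) μ).natAbs = 0 := by
      refine Finset.sum_eq_zero fun μ hμ => ?_
      have hμ' : μ ≠ κ₂ := Finset.ne_of_mem_erase hμ
      simp [hq, hμ']
    have hd : ∑ μ ∈ Finset.univ.erase κ₂, ((q - p') μ).natAbs = ∑ μ ∈ Finset.univ.erase κ₂, ((p - p') μ).natAbs := by
      refine Finset.sum_congr rfl fun μ hμ => ?_
      have hμ' : μ ≠ κ₂ := Finset.ne_of_mem_erase hμ
      simp [hq, hμ']
    omega
  calc ‖t p - t p'‖ ≤ ‖t p - t q‖ + ‖t q - t p'‖ := norm_sub_le_norm_sub_add_norm_sub _ _ _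
    _ ≤ σ * l1norm (p - q) + σ * l1norm (q - p') := add_le_add e1 e2
    _ = σ * l1norm (p - p') := by rw [← hsum]; push_cast; ring

end Paths

/-! ### Normalisation in a real inner product space -/

section Sphere

variable {E : Type*} [NormedAddCommGroup E] [InnerProductSpace ℝ E]

/-- Normalising a non-zero vector gives a unit vector. [folklore] -/
theorem norm_normalize_eq_one {a : E} (ha : a ≠ 0) : ‖(‖a‖⁻¹ • a : E)‖ = 1 := by
  rw [norm_smul, norm_inv, norm_norm, inv_mul_cancel₀ (norm_ne_zero_iff.mpr ha)]

/-- Normalisation is `2/‖a‖`-Lipschitz at `a`: `‖a/‖a‖ − b/‖b‖‖ ≤ 2‖a − b‖/‖a‖`. [folklore] -/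
theorem norm_normalize_sub_normalize_le {a : E} (ha : a ≠ 0) (b : E) :
    ‖(‖a‖⁻¹ • a : E) - ‖b‖⁻¹ • b‖ ≤ 2 * ‖a - b‖ / ‖a‖ := by
  have ha' : 0 < ‖a‖ := norm_pos_iff.mpr ha
  have e1 : (‖a‖⁻¹ • a : E) - ‖b‖⁻¹ • b = ‖a‖⁻¹ • (a - b) + (‖a‖⁻¹ - ‖b‖⁻¹) • b := by
    rw [smul_sub, sub_smul]; abel
  rw [e1]
  refine (norm_add_le _ _).trans ?_
  rw [norm_smul, norm_smul, norm_inv, norm_norm, Real.norm_eq_abs]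
  have h2 : |‖a‖⁻¹ - ‖b‖⁻¹| * ‖b‖ ≤ ‖a - b‖ / ‖a‖ := by
    by_cases hb : b = 0
    · subst hb; simp; positivity
    have hb' : 0 < ‖b‖ := norm_pos_iff.mpr hb
    have e2 : |‖a‖⁻¹ - ‖b‖⁻¹| * ‖b‖ = |‖b‖ - ‖a‖| / ‖a‖ := by
      rw [inv_sub_inv ha'.ne' hb'.ne', abs_div, abs_of_pos (mul_pos ha' hb')]
      field_simp
    rw [e2]
    exact div_le_div_of_nonneg_right ((abs_norm_sub_norm_le b a).trans (by rw [norm_sub_rev])) ha'.le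
  calc ‖a‖⁻¹ * ‖a - b‖ + |‖a‖⁻¹ - ‖b‖⁻¹| * ‖b‖ ≤ ‖a - b‖ / ‖a‖ + ‖a - b‖ / ‖a‖ := by
        rw [inv_mul_eq_div]; exact add_le_add le_rfl h2
    _ = 2 * ‖a - b‖ / ‖a‖ := by ring

/-- THE CHORD LOWER BOUND: for unit `p, q` with `‖p − q‖ ≥ ρ` and `λ ∈ [0, 1]`, `‖−(1−λ)q + λp‖ ≥ ρ/2` (the segment from `−q`
to `p` stays `ρ/2` away from the origin). [folklore] -/
theorem half_le_norm_cone {p q : E} (hp : ‖p‖ = 1) (hq : ‖q‖ = 1) {ρ s : ℝ} (hρ : 0 ≤ ρ) (hρpq : ρ ≤ ‖p - q‖)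
    (hs0 : 0 ≤ s) (hs1 : s ≤ 1) : ρ / 2 ≤ ‖-(1 - s) • q + s • p‖ := by
  have hpq2 : ‖p - q‖ ≤ 2 := by
    calc ‖p - q‖ ≤ ‖p‖ + ‖q‖ := norm_sub_le _ _
      _ = 2 := by rw [hp, hq]; norm_num
  have hin : inner ℝ p q = 1 - ‖p - q‖ ^ 2 / 2 := by
    have h := @norm_sub_sq_real E _ _ p q
    rw [hp, hq] at h
    linarith
  have hsq : ‖-(1 - s) • q + s • p‖ ^ 2 = (1 - 2 * s) ^ 2 + s * (1 - s) * ‖p - q‖ ^ 2 := by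
    rw [@norm_add_sq_real E _ _]
    rw [norm_smul, norm_smul, hp, hq, Real.norm_eq_abs, Real.norm_eq_abs,
      abs_of_nonpos (by linarith : -(1 - s) ≤ 0), abs_of_nonneg hs0, inner_smul_left, inner_smul_right]
    simp only [mul_one, conj_trivial]
    rw [real_inner_comm p q, hin]
    ring
  have hkey : (ρ / 2) ^ 2 ≤ ‖-(1 - s) • q + s • p‖ ^ 2 := by
    rw [hsq]
    have h1 : s * (1 - s) * ρ ^ 2 ≤ s * (1 - s) * ‖p - q‖ ^ 2 :=
      mul_le_mul_of_nonneg_left (pow_le_pow_left₀ hρ hρpq 2) (mul_nonneg hs0 (by linarith))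
    have hρ2 : ρ ^ 2 ≤ 4 := by nlinarith
    have h2 : 0 ≤ (1 - 2 * s) ^ 2 * (4 - ρ ^ 2) := mul_nonneg (sq_nonneg _) (by linarith)
    nlinarith
  nlinarith [norm_nonneg (-(1 - s) • q + s • p), sq_nonneg (‖-(1 - s) • q + s • p‖ - ρ / 2)]

end Sphere

/-! ### The cone extension -/

section ConeExt

variable {E : Type*} [NormedAddCommGroup E]

/-- A lattice bond inside the box points in an active direction. [folklore] -/
theorem mem_D_of_bond {x : Fin d → ℤ} {ι : Fin d} (hx : x ∈ c.box) (hy : x + Pi.single ι 1 ∈ c.box) : ι ∈ c.D := by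
  by_contra h
  have h1 := c.eq_lo_of_not_mem hx h
  have h2 := c.eq_lo_of_not_mem hy h
  simp at h2; omega

/-- KEY STEP: along a lattice bond `(x, y)` of the box, `lam y · ‖t(proj x) − t(proj y)‖ ≤ 2/m + 3|D|σ` for unit boundary
data with bond oscillation `≤ σ` (common face / adjacent faces: lattice path; opposite faces only next to the centre). [folklore] -/
theorem lam_mul_osc_le (hm : 1 ≤ c.m) {t : (Fin d → ℤ) → E} {σ : ℝ} (hσ : 0 ≤ σ) (ht1 : ∀ x ∈ c.bdry, ‖t x‖ = 1)
    (hts : c.BdrySteps t σ) {x : Fin d → ℤ} {ι : Fin d} (hx : x ∈ c.box) (hy : x + Pi.single ι 1 ∈ c.box) :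
    c.lam (x + Pi.single ι 1) * ‖t (c.proj x) - t (c.proj (x + Pi.single ι 1))‖ ≤ 2 / c.m + 3 * c.D.card * σ := by
  set y := x + Pi.single ι 1 with hydef
  have hD : c.D.Nonempty := ⟨ι, c.mem_D_of_bond hx hy⟩
  have hm' : (0 : ℝ) < c.m := by exact_mod_cast hm
  have hcard : (0 : ℝ) ≤ c.D.card := by positivity
  have hpx := c.proj_onBdry x hD
  have hpy := c.proj_onBdry y hD
  have h2 : ‖t (c.proj x) - t (c.proj y)‖ ≤ 2 := by
    calc ‖t (c.proj x) - t (c.proj y)‖ ≤ ‖t (c.proj x)‖ + ‖t (c.proj y)‖ := norm_sub_le _ _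
      _ = 2 := by rw [ht1 _ hpx, ht1 _ hpy]; norm_num
  have hlam0 := c.lam_nonneg y
  -- the two cheap cases
  by_cases hy0 : c.rad y = 0
  · have : c.lam y = 0 := by simp [lam, hy0]
    rw [this, zero_mul]; positivity
  have hsmall : c.rad y ≤ 1 → c.lam y * ‖t (c.proj x) - t (c.proj y)‖ ≤ 2 / c.m + 3 * c.D.card * σ := by
    intro hr1
    have hl : c.lam y ≤ 1 / c.m := by
      unfold lam; exact div_le_div_of_nonneg_right (by exact_mod_cast hr1) hm'.le
    calc c.lam y * ‖t (c.proj x) - t (c.proj y)‖ ≤ (1 / c.m) * 2 := mul_le_mul hl h2 (norm_nonneg _) (by positivity)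
      _ = 2 / c.m := by ring
      _ ≤ 2 / c.m + 3 * c.D.card * σ := by nlinarith
  by_cases hx0 : c.rad x = 0
  · have hr1 : c.rad y ≤ 1 := by have := (c.rad_step x ι).1; rw [hx0] at this; exact this
    exact hsmall hr1
  -- both radii positive: the path bound
  have hpath : ‖t (c.proj x) - t (c.proj y)‖ ≤ σ * l1norm (c.proj x - c.proj y) →
      c.lam y * ‖t (c.proj x) - t (c.proj y)‖ ≤ 2 / c.m + 3 * c.D.card * σ := by
    intro hP
    have hl1 := c.l1_proj_sub_proj_le x ι hx0 hy0
    have hry : (0 : ℝ) < c.rad y := by exact_mod_cast Nat.pos_of_ne_zero hy0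
    have hrym : (c.rad y : ℝ) ≤ c.m := by exact_mod_cast c.rad_le hy
    have step1 : c.lam y * ‖t (c.proj x) - t (c.proj y)‖ ≤ c.lam y * (σ * (c.D.card * (2 * c.m / c.rad y + 1))) :=
      mul_le_mul_of_nonneg_left (hP.trans (mul_le_mul_of_nonneg_left hl1 hσ)) hlam0
    refine step1.trans ?_
    unfold lam
    rw [show (c.rad y : ℝ) / c.m * (σ * (c.D.card * (2 * c.m / c.rad y + 1))) = σ * c.D.card * (2 + c.rad y / c.m) by
      field_simp]
    have h3 : (c.rad y : ℝ) / c.m ≤ 1 := by rw [div_le_one hm']; exact hrym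
    have h4 : σ * c.D.card * (2 + c.rad y / c.m) ≤ σ * c.D.card * 3 :=
      mul_le_mul_of_nonneg_left (by linarith) (mul_nonneg hσ hcard)
    have h5 : (0 : ℝ) < 2 / c.m := by positivity
    linarith
  obtain ⟨κ₁, hκ₁, hv₁⟩ := hpx.2
  obtain ⟨κ₂, hκ₂, hv₂⟩ := hpy.2
  by_cases h12 : κ₁ = κ₂
  · subst h12
    by_cases hv : c.proj x κ₁ = c.proj y κ₁
    · exact hpath (c.face_osc hts hκ₁ hv₁ _ _ _ hpx.1 hpy.1 rfl hv.symm rfl)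
    · -- opposite faces: only possible next to the centre
      apply hsmall
      have hgap : |(c.proj x κ₁ : ℝ) - c.proj y κ₁| = 2 * c.m := by
        rcases hv₁ with h1 | h1 <;> rcases hv₂ with h2 | h2
        · exact absurd (h1.trans h2.symm) hv
        · rw [h1, h2]; push_cast; rw [abs_of_nonpos (by linarith)]; ring
        · rw [h1, h2]; push_cast; rw [abs_of_nonneg (by linarith)]; ring
        · exact absurd (h1.trans h2.symm) hv
      have hb := c.abs_proj_sub_proj_le x ι κ₁ hx0 hy0
      rw [hgap] at hb
      have hry : (0 : ℝ) < c.rad y := by exact_mod_cast Nat.pos_of_ne_zero hy0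
      have hrym : c.rad y ≤ c.m := c.rad_le hy
      by_contra hc
      push Not at hc
      have h2r : (2 : ℝ) ≤ c.rad y := by exact_mod_cast hc
      have hmr : (c.rad y : ℝ) ≤ c.m := by exact_mod_cast hrym
      rw [← hydef] at hb
      have : 2 * (c.m : ℝ) * c.rad y ≤ 2 * c.m + c.rad y := by
        have := (le_div_iff₀ hry).mp (by linarith : 2 * (c.m : ℝ) - 1 ≤ 2 * c.m / c.rad y)
        linarith
      nlinarith
  · exact hpath (c.two_face_osc hts hκ₁ hκ₂ h12 hpx.1 hpy.1 hv₁ hv₂)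

variable [InnerProductSpace ℝ E]

/-- **THE DISCRETE CONE EXTENSION.**  Unit boundary data `t` on the cell `c` (half-side `m ≥ 1`) with bond oscillation `≤ σ`
along the boundary and MISSING THE BALL `B(q, ρ)` about a unit vector `q` extend to the whole lattice with unit values,
agreeing with `t` on `∂B`, and with bond oscillation `≤ (16/m + 12·|D|·σ)/ρ` on the box: `T x = normalize(−(1 − lam x)•q +
lam x • t (proj x))`.  Quantitative `π_{k−1}(sphere) = 0`. [folklore] -/
theorem cone_extension (hm : 1 ≤ c.m) (t : (Fin d → ℤ) → E) {q : E} (hq : ‖q‖ = 1) {σ ρ : ℝ} (hσ : 0 ≤ σ)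
    (hρ : 0 < ρ) (ht1 : ∀ x ∈ c.bdry, ‖t x‖ = 1) (htq : ∀ x ∈ c.bdry, ρ ≤ ‖t x - q‖) (hts : c.BdrySteps t σ) :
    ∃ T : (Fin d → ℤ) → E, (∀ x ∈ c.bdry, T x = t x) ∧ (∀ x, ‖T x‖ = 1) ∧
      ∀ (x : Fin d → ℤ) (ι : Fin d), x ∈ c.box → x + Pi.single ι 1 ∈ c.box →
        ‖T x - T (x + Pi.single ι 1)‖ ≤ (16 / c.m + 12 * c.D.card * σ) / ρ := by
  set a : (Fin d → ℤ) → E := fun x => -(1 - c.lam x) • q + c.lam x • t (c.proj x) with hadef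
  have hm' : (0 : ℝ) < c.m := by exact_mod_cast hm
  -- `a` never vanishes; on a cell with an active direction it stays `ρ/2` away from `0`
  have hlow : ∀ x, c.D.Nonempty → x ∈ c.box → ρ / 2 ≤ ‖a x‖ := fun x hD hx =>
    half_le_norm_cone (ht1 _ (c.proj_onBdry x hD)) hq hρ.le (htq _ (c.proj_onBdry x hD)) (c.lam_nonneg x)
      (c.lam_le_one hx)
  have hne : ∀ x, a x ≠ 0 := by
    intro x
    by_cases h0 : c.rad x = 0
    · have : a x = -q := by simp [hadef, lam, h0]
      rw [this, neg_ne_zero]; rintro rfl; simp at hq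
    · have hD := c.nonempty_of_rad_ne_zero h0
      intro h
      -- `rad x ≠ 0` does not need `x ∈ box` for the lower bound: use the chord bound with `lam x ≤ 1`?
      -- we only know `lam x ≤ 1` on the box; argue directly instead
      have hpx := c.proj_onBdry x hD
      have hx1 : ‖t (c.proj x)‖ = 1 := ht1 _ hpx
      -- from `a x = 0`: `(1 - lam x) • q = lam x • t(proj x)`, take norms
      have e1 : (1 - c.lam x) • q = c.lam x • t (c.proj x) := by
        have : -(1 - c.lam x) • q + c.lam x • t (c.proj x) = 0 := h
        rw [neg_smul, neg_add_eq_zero] at this; exact this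
      have e2 : |1 - c.lam x| = |c.lam x| := by
        have := congrArg (fun v => ‖v‖) e1
        simp only [norm_smul, Real.norm_eq_abs, hq, hx1, mul_one] at this
        exact this
      have hl0 := c.lam_nonneg x
      have hlam : c.lam x = 1 / 2 := by
        rw [abs_of_nonneg hl0] at e2
        rcases le_or_gt (c.lam x) 1 with h | h
        · rw [abs_of_nonneg (by linarith)] at e2; linarith
        · rw [abs_of_neg (by linarith)] at e2; linarith
      -- then `q = t(proj x)`, contradicting `ρ ≤ ‖t(proj x) − q‖`
      rw [hlam] at e1
      have hqt : q = t (c.proj x) := by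
        have := congrArg (fun v => (2 : ℝ) • v) e1
        simp only [smul_smul] at this
        norm_num at this
        exact this
      have := htq _ hpx
      rw [← hqt, sub_self, norm_zero] at this
      exact absurd this (not_le.mpr hρ)
  refine ⟨fun x => ‖a x‖⁻¹ • a x, ?_, fun x => norm_normalize_eq_one (hne x), ?_⟩
  · intro x hx
    have hl := c.lam_eq_one_of_onBdry hx hm
    have hp := c.proj_eq_self_of_onBdry hx hm
    have : a x = t x := by simp [hadef, hl, hp]
    simp only [this, ht1 x hx, inv_one, one_smul]
  · intro x ι hx hy
    set y := x + Pi.single ι 1 with hydef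
    have hD : c.D.Nonempty := ⟨ι, c.mem_D_of_bond hx hy⟩
    have hax := hlow x hD hx
    have hapos : 0 < ‖a x‖ := lt_of_lt_of_le (by positivity) hax
    have step1 := norm_normalize_sub_normalize_le (hne x) (a y)
    have hdiff : a x - a y = (c.lam x - c.lam y) • (q + t (c.proj x)) + c.lam y • (t (c.proj x) - t (c.proj y)) := by
      simp only [hadef]; module
    have hkey := c.lam_mul_osc_le hm hσ ht1 hts hx hy
    have hlam := c.abs_lam_sub_lam_le x ι hm
    have hqt : ‖q + t (c.proj x)‖ ≤ 2 := by
      calc ‖q + t (c.proj x)‖ ≤ ‖q‖ + ‖t (c.proj x)‖ := norm_add_le _ _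
        _ = 2 := by rw [hq, ht1 _ (c.proj_onBdry x hD)]; norm_num
    have hab : ‖a x - a y‖ ≤ 4 / c.m + 3 * c.D.card * σ := by
      rw [hdiff]
      refine (norm_add_le _ _).trans ?_
      rw [norm_smul, norm_smul, Real.norm_eq_abs, Real.norm_eq_abs, abs_of_nonneg (c.lam_nonneg y)]
      have h1 : |c.lam x - c.lam y| * ‖q + t (c.proj x)‖ ≤ 2 / c.m :=
        calc |c.lam x - c.lam y| * ‖q + t (c.proj x)‖ ≤ (1 / c.m) * 2 :=
              mul_le_mul hlam hqt (norm_nonneg _) (by positivity)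
          _ = 2 / c.m := by ring
      rw [← hydef] at hkey
      calc |c.lam x - c.lam y| * ‖q + t (c.proj x)‖ + c.lam y * ‖t (c.proj x) - t (c.proj y)‖
          ≤ 2 / c.m + (2 / c.m + 3 * c.D.card * σ) := add_le_add h1 hkey
        _ = 4 / c.m + 3 * c.D.card * σ := by ring
    calc ‖(‖a x‖⁻¹ • a x : E) - ‖a y‖⁻¹ • a y‖ ≤ 2 * ‖a x - a y‖ / ‖a x‖ := step1
      _ ≤ 2 * ‖a x - a y‖ / (ρ / 2) := div_le_div_of_nonneg_left (by positivity) (by positivity) hax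
      _ = 4 * ‖a x - a y‖ / ρ := by field_simp; ring
      _ ≤ 4 * (4 / c.m + 3 * c.D.card * σ) / ρ := by gcongr
      _ = (16 / c.m + 12 * c.D.card * σ) / ρ := by ring

end ConeExt

end Cell

end Summit.QuantumFields.YangMills.Theorems.FlatRatioTermination.Cone
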